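/- Width seat `ym-line-sfw-p2-w5` (prover-ym-line-sfw-p2-w5-g18-0), free hands for planner ym-idea-2's STUB-PLAN-E (LINE-17
«hypercontractive second-order tilt expansion» on crux `AllWindowsColdBox.BoxMidWindowsSU22` = stmt-QuantumFields-24003, registered stub E
`stub_tiltMoments`), piece E(0), first half: the cubic Taylor polynomial of the cost of four exponentials of skew-Hermitian matrices. -/
import Summits.QuantumFields.YangMills.Theorems.ColdBoxAllGroupsBoxFloorAllGroupsCubicG
import Mathlib.Analysis.Complex.ExponentialBounds

/-!
# The cubic Taylor polynomial of `N − Re tr(e^{A₁}e^{A₂}e^{A₃}e^{A₄})` for skew-Hermitian `Aᵢ` (STUB-PLAN-E, piece E(0), matrix half)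

One order beyond the tree's `ColdBoxAllGroupsBoxFloorAllGroupsCubicG` (`|(N − Re tr Πe^{Aᵢ}) − ½‖ΣAᵢ‖²| ≤ 190·m³`): for skew-Hermitian
`A₁,…,A₄ ∈ M_N(ℂ)` with Frobenius norms `‖Aᵢ‖ ≤ m ≤ 1/4`, `S = ΣAᵢ` and `K = Σ_{i<j}(AᵢAⱼ − AⱼAᵢ)`,

  `|(N − Re tr(e^{A₁}e^{A₂}e^{A₃}e^{A₄})) − ½‖S‖² + ½·Re tr(S·K)| ≤ 560·m⁴`   (`abs_cost_exp_prod_sub_cubic_le`),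

and the plaquette (holonomy) form with `(e^{A₃})⁻¹, (e^{A₄})⁻¹` (`abs_cost_exp_holonomy_sub_cubic_le`: `S = A₁+A₂−A₃−A₄`, signed commutator
sum).  The degree-three Taylor term `−½Re tr(S·K) = −½Σ_{i<j}Re tr(S[Aᵢ,Aⱼ]) = −Σ_{i<j<k}Re tr(AᵢAⱼAₖ)` is an ALTERNATING trilinear form of the
`Aᵢ` (trace cyclicity); the chart form and the per-plaquette statement in the variables of the one-scale expansion are in the sibling file
`AllWindowsColdBoxPlaqCostCubicTaylor`.

Method (no degree-three BCH/word algebra): `N − Re tr U = ½‖U − 1‖_F²` for unitary `U` (tree, `sub_re_trace_eq_half_norm_sub_one_sq`), the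
product of the four exponentials expanded only to SECOND order with a third-order remainder, `U − 1 = S + ½(S² + K) + E`, `‖E‖ ≤ 50·m³`
(`norm_exp_mul_exp_mul_exp_mul_exp_sub_second_order_le`), then `½‖S + Q + E‖² = ½‖S + Q‖² + O(m⁴)` (the tree's scalar step
`abs_half_norm_sq_sub_half_norm_sq_le`), `½‖S + Q‖² = ½‖S‖² + Re tr(SᴴQ) + ½‖Q‖²` (polarisation `frobenius_norm_add_sq`) and
`Re tr(SᴴQ) = −½Re tr(S³) − ½Re tr(S·K) = −½Re tr(S·K)` (`S³` is skew-Hermitian, `re_trace_eq_zero_of_conjTranspose_eq_neg`).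

* §1 (complete normed `ℝ`-algebra) `norm_exp_sub_one_sub_sub_half_sq_le'` (`‖e^X − 1 − X − ½X²‖ ≤ ‖X‖³` for `‖X‖ ≤ 1`, series shifted by
  three + `Real.exp_bound`), `norm_prod_four_sub_second_order_le` (`‖Π(1+Xᵢ) − 1 − ΣXᵢ − Σ_{i<j}XᵢXⱼ‖ ≤ 4t³ + t⁴`),
  **`norm_exp_mul_exp_mul_exp_mul_exp_sub_second_order_le`**.
* §2 (`M_N(ℂ)`, Frobenius) `frobenius_norm_add_sq`, `abs_re_trace_conjTranspose_mul_le` / `abs_re_trace_mul_le` (Cauchy–Schwarz from polarisation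
  and the triangle inequality), `re_trace_eq_zero_of_conjTranspose_eq_neg`, `norm_commutator_le`, **`abs_cost_exp_prod_sub_cubic_le`**,
  **`abs_cost_exp_holonomy_sub_cubic_le`**.

Everything is proved; no definition; standard axioms.  HONEST LABEL: helper toward the open registered stub E of a critic-passed line on the
R2ξ″ RECORD-rung crux 24003; no stub is proved by name, no crux, rung or summit is proved; the Yang–Mills mass gap is NOT proved by this file.
-/

set_option autoImplicit false

noncomputable section

open scoped Matrix Matrix.Norms.Frobenius
open NormedSpace

namespace Summit.QuantumFields.YangMills.Theorems.ColdBoxAllGroups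

/-! ## §1 Third-order bookkeeping in a complete normed algebra -/

section Banach

variable {𝔸 : Type*} [NormedRing 𝔸] [NormedAlgebra ℝ 𝔸] [CompleteSpace 𝔸]

/-- **Third-order Taylor bound of the exponential at `0`** (real scalars): `‖e^X − 1 − X − ½X²‖ ≤ ‖X‖³` for `‖X‖ ≤ 1`
(the exponential series shifted by three, compared termwise with the real series, and `Real.exp_bound`). -/
theorem norm_exp_sub_one_sub_sub_half_sq_le' {X : 𝔸} (hX : ‖X‖ ≤ 1) :
    ‖exp X - 1 - X - (2 : ℝ)⁻¹ • (X * X)‖ ≤ ‖X‖ ^ 3 := by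
  have h1 : HasSum (fun n ↦ ((Nat.factorial n : ℝ)⁻¹) • X ^ n) (exp X) := exp_series_hasSum_exp' (𝕂 := ℝ) X
  have h2 : HasSum (fun n : ℕ ↦ ((Nat.factorial (n + 3) : ℝ)⁻¹) • X ^ (n + 3)) (exp X - 1 - X - (2 : ℝ)⁻¹ • (X * X)) := by
    have h := (hasSum_nat_add_iff' 3).2 h1
    simp only [Finset.sum_range_succ, Finset.sum_range_zero, Nat.factorial_zero, Nat.cast_one, inv_one, pow_zero, one_smul,
      zero_add, Nat.factorial_one, pow_one, Nat.factorial_two, Nat.cast_ofNat] at h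
    have e : exp X - (1 + X + (2 : ℝ)⁻¹ • X ^ 2) = exp X - 1 - X - (2 : ℝ)⁻¹ • (X * X) := by rw [sq]; abel
    rwa [e] at h
  have h1' : HasSum (fun n ↦ ((Nat.factorial n : ℝ)⁻¹) • ‖X‖ ^ n) (Real.exp ‖X‖) := by
    rw [Real.exp_eq_exp_ℝ]
    exact exp_series_hasSum_exp' (𝕂 := ℝ) ‖X‖
  have h3 : HasSum (fun n : ℕ ↦ ((Nat.factorial (n + 3) : ℝ)⁻¹) * ‖X‖ ^ (n + 3))
      (Real.exp ‖X‖ - 1 - ‖X‖ - 2⁻¹ * ‖X‖ ^ 2) := by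
    have h := (hasSum_nat_add_iff' 3).2 h1'
    simp only [Finset.sum_range_succ, Finset.sum_range_zero, Nat.factorial_zero, Nat.cast_one, inv_one, pow_zero, zero_add,
      Nat.factorial_one, pow_one, Nat.factorial_two, Nat.cast_ofNat, smul_eq_mul, one_mul] at h
    have e : Real.exp ‖X‖ - (1 + ‖X‖ + 2⁻¹ * ‖X‖ ^ 2) = Real.exp ‖X‖ - 1 - ‖X‖ - 2⁻¹ * ‖X‖ ^ 2 := by ring
    rwa [e] at h
  have h4 : ∀ n : ℕ, ‖((Nat.factorial (n + 3) : ℝ)⁻¹) • X ^ (n + 3)‖ ≤ ((Nat.factorial (n + 3) : ℝ)⁻¹) * ‖X‖ ^ (n + 3) := by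
    intro n
    rw [norm_smul, norm_inv, Real.norm_natCast]
    exact mul_le_mul_of_nonneg_left (norm_pow_le' _ (by omega)) (by positivity)
  have h5 : Real.exp ‖X‖ - 1 - ‖X‖ - 2⁻¹ * ‖X‖ ^ 2 ≤ ‖X‖ ^ 3 := by
    have hb := Real.exp_bound (x := ‖X‖) (by rwa [abs_of_nonneg (norm_nonneg _)]) (n := 3) (by norm_num)
    simp only [Finset.sum_range_succ, Finset.sum_range_zero, Nat.cast_one, pow_zero, zero_add, pow_one,
      Nat.cast_ofNat, div_one, Nat.factorial, Nat.succ_eq_add_one] at hb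
    rw [abs_of_nonneg (norm_nonneg _)] at hb
    have h6 := (le_abs_self _).trans hb
    have h7 : (0 : ℝ) ≤ ‖X‖ ^ 3 := by positivity
    norm_num at h6
    nlinarith [h6, h7]
  exact (h2.norm_le_of_bounded h3 h4).trans h5

omit [NormedAlgebra ℝ 𝔸] [CompleteSpace 𝔸] in
/-- **Third-order expansion of a product of four near-identity elements**:
`‖Π(1+Xᵢ) − 1 − ΣXᵢ − Σ_{i<j}XᵢXⱼ‖ ≤ 4t³ + t⁴` for `‖Xᵢ‖ ≤ t` (the left-hand side is `Σ_{i<j<k}XᵢXⱼXₖ + X₁X₂X₃X₄`). -/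
theorem norm_prod_four_sub_second_order_le {X₁ X₂ X₃ X₄ : 𝔸} {t : ℝ} (h₁ : ‖X₁‖ ≤ t) (h₂ : ‖X₂‖ ≤ t) (h₃ : ‖X₃‖ ≤ t)
    (h₄ : ‖X₄‖ ≤ t) :
    ‖(1 + X₁) * (1 + X₂) * (1 + X₃) * (1 + X₄) - 1 - (X₁ + X₂ + X₃ + X₄) -
        (X₁ * X₂ + X₁ * X₃ + X₁ * X₄ + X₂ * X₃ + X₂ * X₄ + X₃ * X₄)‖ ≤ 4 * t ^ 3 + t ^ 4 := by
  have ht : 0 ≤ t := (norm_nonneg _).trans h₁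
  have e : (1 + X₁) * (1 + X₂) * (1 + X₃) * (1 + X₄) - 1 - (X₁ + X₂ + X₃ + X₄) -
      (X₁ * X₂ + X₁ * X₃ + X₁ * X₄ + X₂ * X₃ + X₂ * X₄ + X₃ * X₄) =
      X₁ * X₂ * X₃ + X₁ * X₂ * X₄ + X₁ * X₃ * X₄ + X₂ * X₃ * X₄ + X₁ * X₂ * X₃ * X₄ := by
    noncomm_ring
  rw [e]
  have h3 : ∀ (A B C : 𝔸), ‖A‖ ≤ t → ‖B‖ ≤ t → ‖C‖ ≤ t → ‖A * B * C‖ ≤ t ^ 3 := by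
    intro A B C hA hB hC
    calc ‖A * B * C‖ ≤ ‖A‖ * ‖B‖ * ‖C‖ := norm_mul₃_le
      _ ≤ t * t * t := mul_le_mul (mul_le_mul hA hB (norm_nonneg _) ht) hC (norm_nonneg _) (mul_nonneg ht ht)
      _ = t ^ 3 := by ring
  have h4' : ‖X₁ * X₂ * X₃ * X₄‖ ≤ t ^ 4 := by
    calc ‖X₁ * X₂ * X₃ * X₄‖ ≤ ‖X₁ * X₂ * X₃‖ * ‖X₄‖ := norm_mul_le _ _
      _ ≤ t ^ 3 * t := mul_le_mul (h3 _ _ _ h₁ h₂ h₃) h₄ (norm_nonneg _) (pow_nonneg ht 3)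
      _ = t ^ 4 := by ring
  have hs : ‖X₁ * X₂ * X₃ + X₁ * X₂ * X₄ + X₁ * X₃ * X₄ + X₂ * X₃ * X₄‖ ≤ t ^ 3 + t ^ 3 + t ^ 3 + t ^ 3 :=
    norm_add_le_of_le (norm_add_le_of_le (norm_add_le_of_le (h3 _ _ _ h₁ h₂ h₃) (h3 _ _ _ h₁ h₂ h₄))
      (h3 _ _ _ h₁ h₃ h₄)) (h3 _ _ _ h₂ h₃ h₄)
  calc _ ≤ (t ^ 3 + t ^ 3 + t ^ 3 + t ^ 3) + t ^ 4 := norm_add_le_of_le hs h4'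
    _ = 4 * t ^ 3 + t ^ 4 := by ring

/-- **Second-order expansion of a product of four exponentials with a third-order remainder.**  For `‖Aᵢ‖ ≤ m ≤ 1/4`, with
`S = A₁+A₂+A₃+A₄` and `K = Σ_{i<j} [Aᵢ, Aⱼ]` (commutators in the order of the product):
`‖e^{A₁}e^{A₂}e^{A₃}e^{A₄} − 1 − S − ½(S² + K)‖ ≤ 50·m³` (`½(S² + K) = Σᵢ ½Aᵢ² + Σ_{i<j} AᵢAⱼ` is the degree-two part of the product;
`e^{Aᵢ} = 1 + Aᵢ + ½Aᵢ² + O(m³)`, pair products `XᵢXⱼ = AᵢAⱼ + O(m³)`, triple products `O(m³)`). -/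
theorem norm_exp_mul_exp_mul_exp_mul_exp_sub_second_order_le {A₁ A₂ A₃ A₄ : 𝔸} {m : ℝ} (hm : m ≤ 1 / 4) (h₁ : ‖A₁‖ ≤ m)
    (h₂ : ‖A₂‖ ≤ m) (h₃ : ‖A₃‖ ≤ m) (h₄ : ‖A₄‖ ≤ m) :
    ‖exp A₁ * exp A₂ * exp A₃ * exp A₄ - 1 - (A₁ + A₂ + A₃ + A₄) -
        (2 : ℝ)⁻¹ • ((A₁ + A₂ + A₃ + A₄) * (A₁ + A₂ + A₃ + A₄) +
          ((A₁ * A₂ - A₂ * A₁) + (A₁ * A₃ - A₃ * A₁) + (A₁ * A₄ - A₄ * A₁) + (A₂ * A₃ - A₃ * A₂) +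
            (A₂ * A₄ - A₄ * A₂) + (A₃ * A₄ - A₄ * A₃)))‖ ≤ 50 * m ^ 3 := by
  have hm0 : 0 ≤ m := (norm_nonneg _).trans h₁
  have hm1 : m ≤ 1 := hm.trans (by norm_num)
  -- the pieces `Xᵢ = e^{Aᵢ} − 1`, `Xᵢ − Aᵢ`, `Rᵢ = e^{Aᵢ} − 1 − Aᵢ − ½Aᵢ²`
  have hX : ∀ {A : 𝔸}, ‖A‖ ≤ m → ‖exp A - 1‖ ≤ 3 / 2 * m := fun {A} hA =>
    (norm_exp_sub_one_le' (hA.trans hm)).trans (by linarith)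
  have hXA : ∀ {A : 𝔸}, ‖A‖ ≤ m → ‖exp A - 1 - A‖ ≤ 2 * m ^ 2 := fun {A} hA =>
    (norm_exp_sub_one_sub_le (hA.trans hm1)).trans
      (by nlinarith [norm_nonneg A, pow_le_pow_left₀ (norm_nonneg _) hA 2])
  have hR : ∀ {A : 𝔸}, ‖A‖ ≤ m → ‖exp A - 1 - A - (2 : ℝ)⁻¹ • (A * A)‖ ≤ m ^ 3 := fun {A} hA =>
    (norm_exp_sub_one_sub_sub_half_sq_le' (hA.trans hm1)).trans (pow_le_pow_left₀ (norm_nonneg _) hA 3)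
  -- pair differences `XᵢXⱼ − AᵢAⱼ = (Xᵢ − Aᵢ)Xⱼ + Aᵢ(Xⱼ − Aⱼ)`
  have hP : ∀ {A B : 𝔸}, ‖A‖ ≤ m → ‖B‖ ≤ m → ‖(exp A - 1) * (exp B - 1) - A * B‖ ≤ 5 * m ^ 3 := by
    intro A B hA hB
    have e : (exp A - 1) * (exp B - 1) - A * B = (exp A - 1 - A) * (exp B - 1) + A * (exp B - 1 - B) := by
      noncomm_ring
    rw [e]
    refine (norm_add_le_of_le ((norm_mul_le _ _).trans
      (mul_le_mul (hXA hA) (hX hB) (norm_nonneg _) (by positivity)))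
      ((norm_mul_le _ _).trans (mul_le_mul hA (hXA hB) (norm_nonneg _) hm0))).trans ?_
    nlinarith
  have hprod := norm_prod_four_sub_second_order_le (hX h₁) (hX h₂) (hX h₃) (hX h₄)
  have e1 : (1 + (exp A₁ - 1)) * (1 + (exp A₂ - 1)) * (1 + (exp A₃ - 1)) * (1 + (exp A₄ - 1)) =
      exp A₁ * exp A₂ * exp A₃ * exp A₄ := by simp
  rw [e1] at hprod
  -- the degree-two part in the two forms
  have hQ : (2 : ℝ)⁻¹ • ((A₁ + A₂ + A₃ + A₄) * (A₁ + A₂ + A₃ + A₄) +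
      ((A₁ * A₂ - A₂ * A₁) + (A₁ * A₃ - A₃ * A₁) + (A₁ * A₄ - A₄ * A₁) + (A₂ * A₃ - A₃ * A₂) +
        (A₂ * A₄ - A₄ * A₂) + (A₃ * A₄ - A₄ * A₃))) =
      (2 : ℝ)⁻¹ • (A₁ * A₁) + (2 : ℝ)⁻¹ • (A₂ * A₂) + (2 : ℝ)⁻¹ • (A₃ * A₃) + (2 : ℝ)⁻¹ • (A₄ * A₄) +
        (A₁ * A₂ + A₁ * A₃ + A₁ * A₄ + A₂ * A₃ + A₂ * A₄ + A₃ * A₄) := by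
    have e : (A₁ + A₂ + A₃ + A₄) * (A₁ + A₂ + A₃ + A₄) +
        ((A₁ * A₂ - A₂ * A₁) + (A₁ * A₃ - A₃ * A₁) + (A₁ * A₄ - A₄ * A₁) + (A₂ * A₃ - A₃ * A₂) +
          (A₂ * A₄ - A₄ * A₂) + (A₃ * A₄ - A₄ * A₃)) =
        (A₁ * A₁ + A₂ * A₂ + A₃ * A₃ + A₄ * A₄) +
          ((A₁ * A₂ + A₁ * A₃ + A₁ * A₄ + A₂ * A₃ + A₂ * A₄ + A₃ * A₄) +
            (A₁ * A₂ + A₁ * A₃ + A₁ * A₄ + A₂ * A₃ + A₂ * A₄ + A₃ * A₄)) := by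
      noncomm_ring
    rw [e]
    module
  have e2 : exp A₁ * exp A₂ * exp A₃ * exp A₄ - 1 - (A₁ + A₂ + A₃ + A₄) -
      ((2 : ℝ)⁻¹ • (A₁ * A₁) + (2 : ℝ)⁻¹ • (A₂ * A₂) + (2 : ℝ)⁻¹ • (A₃ * A₃) + (2 : ℝ)⁻¹ • (A₄ * A₄) +
        (A₁ * A₂ + A₁ * A₃ + A₁ * A₄ + A₂ * A₃ + A₂ * A₄ + A₃ * A₄)) =
      (exp A₁ * exp A₂ * exp A₃ * exp A₄ - 1 - ((exp A₁ - 1) + (exp A₂ - 1) + (exp A₃ - 1) + (exp A₄ - 1)) -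
          ((exp A₁ - 1) * (exp A₂ - 1) + (exp A₁ - 1) * (exp A₃ - 1) + (exp A₁ - 1) * (exp A₄ - 1) +
            (exp A₂ - 1) * (exp A₃ - 1) + (exp A₂ - 1) * (exp A₄ - 1) + (exp A₃ - 1) * (exp A₄ - 1))) +
        ((exp A₁ - 1 - A₁ - (2 : ℝ)⁻¹ • (A₁ * A₁)) + (exp A₂ - 1 - A₂ - (2 : ℝ)⁻¹ • (A₂ * A₂)) +
          (exp A₃ - 1 - A₃ - (2 : ℝ)⁻¹ • (A₃ * A₃)) + (exp A₄ - 1 - A₄ - (2 : ℝ)⁻¹ • (A₄ * A₄))) +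
        (((exp A₁ - 1) * (exp A₂ - 1) - A₁ * A₂) + ((exp A₁ - 1) * (exp A₃ - 1) - A₁ * A₃) +
          ((exp A₁ - 1) * (exp A₄ - 1) - A₁ * A₄) + ((exp A₂ - 1) * (exp A₃ - 1) - A₂ * A₃) +
          ((exp A₂ - 1) * (exp A₄ - 1) - A₂ * A₄) + ((exp A₃ - 1) * (exp A₄ - 1) - A₃ * A₄)) := by
    abel
  rw [hQ, e2]
  have hRs : ‖(exp A₁ - 1 - A₁ - (2 : ℝ)⁻¹ • (A₁ * A₁)) + (exp A₂ - 1 - A₂ - (2 : ℝ)⁻¹ • (A₂ * A₂)) +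
      (exp A₃ - 1 - A₃ - (2 : ℝ)⁻¹ • (A₃ * A₃)) + (exp A₄ - 1 - A₄ - (2 : ℝ)⁻¹ • (A₄ * A₄))‖ ≤
      m ^ 3 + m ^ 3 + m ^ 3 + m ^ 3 :=
    norm_add_le_of_le (norm_add_le_of_le (norm_add_le_of_le (hR h₁) (hR h₂)) (hR h₃)) (hR h₄)
  have hPs : ‖((exp A₁ - 1) * (exp A₂ - 1) - A₁ * A₂) + ((exp A₁ - 1) * (exp A₃ - 1) - A₁ * A₃) +
      ((exp A₁ - 1) * (exp A₄ - 1) - A₁ * A₄) + ((exp A₂ - 1) * (exp A₃ - 1) - A₂ * A₃) +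
      ((exp A₂ - 1) * (exp A₄ - 1) - A₂ * A₄) + ((exp A₃ - 1) * (exp A₄ - 1) - A₃ * A₄)‖ ≤
      5 * m ^ 3 + 5 * m ^ 3 + 5 * m ^ 3 + 5 * m ^ 3 + 5 * m ^ 3 + 5 * m ^ 3 :=
    norm_add_le_of_le (norm_add_le_of_le (norm_add_le_of_le (norm_add_le_of_le (norm_add_le_of_le
      (hP h₁ h₂) (hP h₁ h₃)) (hP h₁ h₄)) (hP h₂ h₃)) (hP h₂ h₄)) (hP h₃ h₄)
  have hm4 : m ^ 4 ≤ m ^ 3 * (1 / 4) := by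
    calc m ^ 4 = m ^ 3 * m := by ring
      _ ≤ m ^ 3 * (1 / 4) := mul_le_mul_of_nonneg_left hm (pow_nonneg hm0 3)
  refine (norm_add_le_of_le (norm_add_le_of_le hprod hRs) hPs).trans ?_
  nlinarith [hm4, pow_nonneg hm0 3]

end Banach

/-! ## §2 The cubic Taylor polynomial of the cost of four exponentials of skew-Hermitian matrices -/

section Matrices

variable {N : ℕ}

/-- **Polarisation of the Frobenius norm**: `‖X + Y‖² = ‖X‖² + 2·Re tr(Xᴴ Y) + ‖Y‖²`. -/
theorem frobenius_norm_add_sq (X Y : Matrix (Fin N) (Fin N) ℂ) :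
    ‖X + Y‖ ^ 2 = ‖X‖ ^ 2 + 2 * (Xᴴ * Y).trace.re + ‖Y‖ ^ 2 := by
  have hXY : (Yᴴ * X).trace.re = (Xᴴ * Y).trace.re := by
    have h : Yᴴ * X = (Xᴴ * Y)ᴴ := by rw [Matrix.conjTranspose_mul, Matrix.conjTranspose_conjTranspose]
    rw [h, Matrix.trace_conjTranspose, Complex.star_def, Complex.conj_re]
  have h1 := Matrix.frobenius_norm_sq_eq_re_trace (X + Y)
  have h2 := Matrix.frobenius_norm_sq_eq_re_trace X
  have h3 := Matrix.frobenius_norm_sq_eq_re_trace Y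
  simp only [RCLike.re_to_complex] at h1 h2 h3
  rw [h1, h2, h3]
  simp only [Matrix.conjTranspose_add, Matrix.add_mul, Matrix.mul_add, Matrix.trace_add, Complex.add_re, hXY]
  ring

/-- **Cauchy–Schwarz for the Frobenius pairing** (from polarisation and the triangle inequality): `|Re tr(Xᴴ Y)| ≤ ‖X‖·‖Y‖`. -/
theorem abs_re_trace_conjTranspose_mul_le (X Y : Matrix (Fin N) (Fin N) ℂ) : |(Xᴴ * Y).trace.re| ≤ ‖X‖ * ‖Y‖ := by
  have hp := frobenius_norm_add_sq X Y
  have hn := frobenius_norm_add_sq X (-Y)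
  rw [Matrix.mul_neg, Matrix.trace_neg, Complex.neg_re, norm_neg] at hn
  have h1 : ‖X + Y‖ ^ 2 ≤ (‖X‖ + ‖Y‖) ^ 2 := pow_le_pow_left₀ (norm_nonneg _) (norm_add_le _ _) 2
  have h2 : ‖X + -Y‖ ^ 2 ≤ (‖X‖ + ‖Y‖) ^ 2 :=
    pow_le_pow_left₀ (norm_nonneg _) ((norm_add_le _ _).trans (by rw [norm_neg])) 2
  rw [abs_le]
  constructor <;> nlinarith [norm_nonneg X, norm_nonneg Y]

/-- `|Re tr(X Y)| ≤ ‖X‖·‖Y‖` (Frobenius norms). -/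
theorem abs_re_trace_mul_le (X Y : Matrix (Fin N) (Fin N) ℂ) : |(X * Y).trace.re| ≤ ‖X‖ * ‖Y‖ := by
  have h := abs_re_trace_conjTranspose_mul_le Xᴴ Y
  rwa [Matrix.conjTranspose_conjTranspose, Matrix.frobenius_norm_conjTranspose] at h

/-- The trace of a skew-Hermitian matrix is purely imaginary. -/
theorem re_trace_eq_zero_of_conjTranspose_eq_neg {M : Matrix (Fin N) (Fin N) ℂ} (hM : Mᴴ = -M) : M.trace.re = 0 := by
  have h := Matrix.trace_conjTranspose M
  rw [hM, Matrix.trace_neg, Complex.star_def] at h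
  have h' := congrArg Complex.re h
  rw [Complex.neg_re, Complex.conj_re] at h'
  linarith

/-- A commutator of two matrices of norm `≤ m` has norm `≤ 2m²`. -/
theorem norm_commutator_le {A B : Matrix (Fin N) (Fin N) ℂ} {m : ℝ} (hA : ‖A‖ ≤ m) (hB : ‖B‖ ≤ m) :
    ‖A * B - B * A‖ ≤ 2 * m ^ 2 := by
  have hm : 0 ≤ m := (norm_nonneg _).trans hA
  have h1 : ‖A * B‖ ≤ m * m := (norm_mul_le _ _).trans (mul_le_mul hA hB (norm_nonneg _) hm)
  have h2 : ‖B * A‖ ≤ m * m := (norm_mul_le _ _).trans (mul_le_mul hB hA (norm_nonneg _) hm)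
  calc ‖A * B - B * A‖ ≤ ‖A * B‖ + ‖B * A‖ := norm_sub_le _ _
    _ ≤ 2 * m ^ 2 := by nlinarith

/-- **The cubic Taylor polynomial of the plaquette cost, matrix form.**  For SKEW-HERMITIAN `A₁,…,A₄` with `‖Aᵢ‖_F ≤ m ≤ 1/4`, `S = ΣAᵢ` and
`K = Σ_{i<j}(AᵢAⱼ − AⱼAᵢ)`:  `|(N − Re tr(e^{A₁}e^{A₂}e^{A₃}e^{A₄})) − ½‖S‖_F² + ½Re tr(S·K)| ≤ 560·m⁴`. -/
theorem abs_cost_exp_prod_sub_cubic_le {A₁ A₂ A₃ A₄ : Matrix (Fin N) (Fin N) ℂ} (hA₁ : A₁ᴴ = -A₁) (hA₂ : A₂ᴴ = -A₂)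
    (hA₃ : A₃ᴴ = -A₃) (hA₄ : A₄ᴴ = -A₄) {m : ℝ} (hm : m ≤ 1 / 4) (h₁ : ‖A₁‖ ≤ m) (h₂ : ‖A₂‖ ≤ m) (h₃ : ‖A₃‖ ≤ m)
    (h₄ : ‖A₄‖ ≤ m) :
    |((N : ℝ) - (exp A₁ * exp A₂ * exp A₃ * exp A₄).trace.re) - ‖A₁ + A₂ + A₃ + A₄‖ ^ 2 / 2 +
        ((A₁ + A₂ + A₃ + A₄) * ((A₁ * A₂ - A₂ * A₁) + (A₁ * A₃ - A₃ * A₁) + (A₁ * A₄ - A₄ * A₁) + (A₂ * A₃ - A₃ * A₂) +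
          (A₂ * A₄ - A₄ * A₂) + (A₃ * A₄ - A₄ * A₃))).trace.re / 2| ≤ 560 * m ^ 4 := by
  have hm0 : 0 ≤ m := (norm_nonneg _).trans h₁
  have hU : exp A₁ * exp A₂ * exp A₃ * exp A₄ ∈ Matrix.unitaryGroup (Fin N) ℂ :=
    mul_mem (mul_mem (mul_mem (FreeEnergyLogCoefficient.exp_mem_unitaryGroup_of_skew hA₁)
      (FreeEnergyLogCoefficient.exp_mem_unitaryGroup_of_skew hA₂))
      (FreeEnergyLogCoefficient.exp_mem_unitaryGroup_of_skew hA₃)) (FreeEnergyLogCoefficient.exp_mem_unitaryGroup_of_skew hA₄)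
  rw [Literature.MathematicalPhysics.QuantumFieldTheory.sub_re_trace_eq_half_norm_sub_one_sq hU]
  set S := A₁ + A₂ + A₃ + A₄ with hS
  set K := (A₁ * A₂ - A₂ * A₁) + (A₁ * A₃ - A₃ * A₁) + (A₁ * A₄ - A₄ * A₁) + (A₂ * A₃ - A₃ * A₂) +
    (A₂ * A₄ - A₄ * A₂) + (A₃ * A₄ - A₄ * A₃) with hK
  set Q := (2 : ℝ)⁻¹ • (S * S + K) with hQ
  set E := exp A₁ * exp A₂ * exp A₃ * exp A₄ - 1 - S - Q with hE
  have hEle : ‖E‖ ≤ 50 * m ^ 3 := norm_exp_mul_exp_mul_exp_mul_exp_sub_second_order_le hm h₁ h₂ h₃ h₄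
  -- `S` is skew-Hermitian of norm `≤ 4m`; `K`, `Q` are quadratic
  have hSskew : Sᴴ = -S := by
    rw [hS, Matrix.conjTranspose_add, Matrix.conjTranspose_add, Matrix.conjTranspose_add, hA₁, hA₂, hA₃, hA₄]
    abel
  have hSle : ‖S‖ ≤ 4 * m := by
    rw [hS]
    exact norm_add_le_of_le (norm_add_le_of_le (norm_add_le_of_le h₁ h₂) h₃) h₄ |>.trans (by linarith)
  have hKle : ‖K‖ ≤ 12 * m ^ 2 := by
    rw [hK]
    exact (norm_add_le_of_le (norm_add_le_of_le (norm_add_le_of_le (norm_add_le_of_le (norm_add_le_of_le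
      (norm_commutator_le h₁ h₂) (norm_commutator_le h₁ h₃)) (norm_commutator_le h₁ h₄)) (norm_commutator_le h₂ h₃))
      (norm_commutator_le h₂ h₄)) (norm_commutator_le h₃ h₄)).trans (by linarith)
  have hQle : ‖Q‖ ≤ 14 * m ^ 2 := by
    rw [hQ, norm_smul, norm_inv, Real.norm_ofNat]
    have hSS : ‖S * S‖ ≤ 4 * m * (4 * m) := (norm_mul_le _ _).trans (mul_le_mul hSle hSle (norm_nonneg _) (by positivity))
    have := norm_add_le_of_le hSS hKle
    nlinarith
  -- `U − 1 = (S + Q) + E`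
  have hV : exp A₁ * exp A₂ * exp A₃ * exp A₄ - 1 = S + Q + E := by rw [hE]; abel
  rw [hV]
  have hsQ : ‖S + Q‖ ≤ 4 * (m + 7 / 2 * m ^ 2) := (norm_add_le_of_le hSle hQle).trans (by linarith)
  have hstep := abs_half_norm_sq_sub_half_norm_sq_le hsQ hEle
  -- the polarised middle term
  have hpol : ‖S + Q‖ ^ 2 = ‖S‖ ^ 2 + 2 * (Sᴴ * Q).trace.re + ‖Q‖ ^ 2 := frobenius_norm_add_sq S Q
  have hS3 : (S * (S * S)).trace.re = 0 := by
    refine re_trace_eq_zero_of_conjTranspose_eq_neg ?_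
    rw [Matrix.conjTranspose_mul, Matrix.conjTranspose_mul, hSskew, neg_mul_neg, mul_neg, Matrix.mul_assoc]
  have hcross : (Sᴴ * Q).trace.re = -((S * K).trace.re / 2) := by
    rw [hSskew, neg_mul, Matrix.trace_neg, Complex.neg_re]
    have hSQ : S * Q = (2 : ℝ)⁻¹ • (S * (S * S) + S * K) := by rw [hQ, Matrix.mul_smul, Matrix.mul_add]
    rw [hSQ, Matrix.trace_smul, Complex.smul_re, Matrix.trace_add, Complex.add_re, hS3, zero_add, smul_eq_mul]
    ring
  have key : ‖S + Q + E‖ ^ 2 / 2 - ‖S‖ ^ 2 / 2 + (S * K).trace.re / 2 =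
      (‖S + Q + E‖ ^ 2 / 2 - ‖S + Q‖ ^ 2 / 2) + ‖Q‖ ^ 2 / 2 := by
    rw [hpol, hcross]; ring
  rw [key]
  have hQsq : ‖Q‖ ^ 2 ≤ (14 * m ^ 2) ^ 2 := pow_le_pow_left₀ (norm_nonneg _) hQle 2
  have hm5 : m ^ 5 ≤ m ^ 4 * (1 / 4) := by
    calc m ^ 5 = m ^ 4 * m := by ring
      _ ≤ m ^ 4 * (1 / 4) := mul_le_mul_of_nonneg_left hm (pow_nonneg hm0 4)
  have hm6 : m ^ 6 ≤ m ^ 4 * (1 / 16) := by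
    have hm2 : m ^ 2 ≤ (1 / 4) ^ 2 := pow_le_pow_left₀ hm0 hm 2
    calc m ^ 6 = m ^ 4 * m ^ 2 := by ring
      _ ≤ m ^ 4 * (1 / 4) ^ 2 := mul_le_mul_of_nonneg_left hm2 (pow_nonneg hm0 4)
      _ = m ^ 4 * (1 / 16) := by norm_num
  calc |‖S + Q + E‖ ^ 2 / 2 - ‖S + Q‖ ^ 2 / 2 + ‖Q‖ ^ 2 / 2|
      ≤ |‖S + Q + E‖ ^ 2 / 2 - ‖S + Q‖ ^ 2 / 2| + |‖Q‖ ^ 2 / 2| := abs_add_le _ _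
    _ ≤ (4 * (m + 7 / 2 * m ^ 2) * (50 * m ^ 3) + (50 * m ^ 3) ^ 2 / 2) + (14 * m ^ 2) ^ 2 / 2 := by
        refine add_le_add hstep ?_
        rw [abs_of_nonneg (by positivity)]
        linarith
    _ ≤ 560 * m ^ 4 := by nlinarith [hm5, hm6, pow_nonneg hm0 4]

/-- **Cubic Taylor polynomial, plaquette form**: for skew-Hermitian `A₁,…,A₄` with `‖Aᵢ‖_F ≤ m ≤ 1/4`, the cost of the holonomy
`e^{A₁}e^{A₂}(e^{A₃})⁻¹(e^{A₄})⁻¹` is `½‖S‖² − ½Re tr(S·K±)` up to `560·m⁴`, where `S = A₁+A₂−A₃−A₄` is the linear circulation and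
`K± = [A₁,A₂] − [A₁,A₃] − [A₁,A₄] − [A₂,A₃] − [A₂,A₄] + [A₃,A₄]` the signed sum of commutators. -/
theorem abs_cost_exp_holonomy_sub_cubic_le {A₁ A₂ A₃ A₄ : Matrix (Fin N) (Fin N) ℂ} (hA₁ : A₁ᴴ = -A₁) (hA₂ : A₂ᴴ = -A₂)
    (hA₃ : A₃ᴴ = -A₃) (hA₄ : A₄ᴴ = -A₄) {m : ℝ} (hm : m ≤ 1 / 4) (h₁ : ‖A₁‖ ≤ m) (h₂ : ‖A₂‖ ≤ m) (h₃ : ‖A₃‖ ≤ m)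
    (h₄ : ‖A₄‖ ≤ m) :
    |((N : ℝ) - (exp A₁ * exp A₂ * (exp A₃)⁻¹ * (exp A₄)⁻¹).trace.re) - ‖A₁ + A₂ - A₃ - A₄‖ ^ 2 / 2 +
        ((A₁ + A₂ - A₃ - A₄) * ((A₁ * A₂ - A₂ * A₁) - (A₁ * A₃ - A₃ * A₁) - (A₁ * A₄ - A₄ * A₁) - (A₂ * A₃ - A₃ * A₂) -
          (A₂ * A₄ - A₄ * A₂) + (A₃ * A₄ - A₄ * A₃))).trace.re / 2| ≤ 560 * m ^ 4 := by
  rw [inv_exp_eq_exp_neg, inv_exp_eq_exp_neg]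
  have hA₃' : (-A₃)ᴴ = -(-A₃) := by rw [Matrix.conjTranspose_neg, hA₃]
  have hA₄' : (-A₄)ᴴ = -(-A₄) := by rw [Matrix.conjTranspose_neg, hA₄]
  have h := abs_cost_exp_prod_sub_cubic_le hA₁ hA₂ hA₃' hA₄' hm h₁ h₂ (by rwa [norm_neg]) (by rwa [norm_neg])
  have e1 : A₁ + A₂ + -A₃ + -A₄ = A₁ + A₂ - A₃ - A₄ := by abel
  have e2 : (A₁ * A₂ - A₂ * A₁) + (A₁ * -A₃ - -A₃ * A₁) + (A₁ * -A₄ - -A₄ * A₁) + (A₂ * -A₃ - -A₃ * A₂) +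
      (A₂ * -A₄ - -A₄ * A₂) + (-A₃ * -A₄ - -A₄ * -A₃) =
      (A₁ * A₂ - A₂ * A₁) - (A₁ * A₃ - A₃ * A₁) - (A₁ * A₄ - A₄ * A₁) - (A₂ * A₃ - A₃ * A₂) -
        (A₂ * A₄ - A₄ * A₂) + (A₃ * A₄ - A₄ * A₃) := by
    simp only [mul_neg, neg_mul, neg_neg]; abel
  rwa [e1, e2] at h

end Matrices

end Summit.QuantumFields.YangMills.Theorems.ColdBoxAllGroups

end
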